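import Summits.HodgeConjecture.HodgeConjecture.Theorems.HodgeLocusCensusPlaneRank
import Summits.HodgeConjecture.HodgeConjecture.Theorems.HodgeLocusCensusPlaneRank6
import HarnessLib

/-!
# HodgeLocusCensusPiPrimeRank — PROVED: the census rows `rankPiPrime_4_4` (rank 6) and `rankPiPrime_6_4` (rank 19) of `HodgeLocusCensusGrassmannianCells` (cell pub-hlocus, LEAD gen 4, (T29))
HONEST FRAMING: certified instances and evidence bearing on the general Hodge conjecture; no claim.

The typed rows for the single linear subspace Π′ of the (±)-cells [Z] ± [Π′] — Π′ = V(x₀ − ζx₁, x₂ − ζx₃, x₄ − ζ³x₅) ⊂ X⁴₄ and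
Π′ = V(x₀ − ζx₁, x₂ − ζx₃, x₄ − ζ³x₅, x₆ − ζx₇) ⊂ X⁴₆ — are instances of the general plane-rank theorems `PlaneRank.ivhsRankEq_plane`
(rank 6 = 15 − 9 for every coordinate plane of the quartic fourfold) and `PlaneRank6.ivhsRankEq_plane64` (rank 19 = 35 − 16 for every coordinate
3-plane of the quartic sixfold): `piPrime4 = plane44 0 0 1`, `piPrime6 = plane64 0 0 1 0` by definition. Numerics of record: engines A (exact) = B: 6, 19.
The (8,4) analogue `rankPiPrime_8_4` (rank 45 = 70 − 25) needs the quartic-eightfold plane-rank theorem and stays typed-open here.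
-/

namespace Summit.HodgeConjecture.HodgeConjecture.HodgeLocus.Census.PiPrime
open GrSection

/-- the census row `rankPiPrime_4_4` HOLDS: rank M_Π′ = 6 on X⁴₄. -/
theorem rankPiPrime_4_4_holds : rankPiPrime_4_4 := by
  unfold rankPiPrime_4_4 piPrime4
  exact PlaneRank.ivhsRankEq_plane 0 0 1

/-- the census row `rankPiPrime_6_4` HOLDS: rank M_Π′ = 19 on X⁴₆. -/
theorem rankPiPrime_6_4_holds : rankPiPrime_6_4 := by
  unfold rankPiPrime_6_4 piPrime6
  exact PlaneRank6.ivhsRankEq_plane64 0 0 1 0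

/-- the two codimension counts: 6 = C(6,4) − 3·3 and 19 = C(7,4) − 4·4 (and the pending 45 = C(8,4) − 5·5). -/
theorem piPrime_codim_counts : Nat.choose 6 4 - 3 * 3 = 6 ∧ Nat.choose 7 4 - 4 * 4 = 19 ∧ Nat.choose 8 4 - 5 * 5 = 45 := by decide

end Summit.HodgeConjecture.HodgeConjecture.HodgeLocus.Census.PiPrime
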